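import Summits.ValiantsHypothesis.ValiantsHypothesis.Theorems.LacunarySymmetroidMatrixDescartesDoorA26WallBubblingBubblingTwistedRolle

/-!
# Real exponential sums: the robust term count at a coincidence, SECOND ORDER (and order `k`) — line `wall_bubbling`, W4

Helper for the line `Cruxes/DoorA26/Lines/wall_bubbling.lean` (stmt-ValiantsHypothesis-19979, `Theses.LacunarySymmetroid.DoorA26`),
obligations (M) `Stmt.stub_mixedWalls` / (W) `Stmt.stub_weylFaces`; seat val-sym-lift-p1 (g19) as W4 of the re-point roster (desk R2664 /
director R260), `--supports stmt-ValiantsHypothesis-19979 --as helper`.  Currency of the chain's module `…BubblingTwistedRolle` (p618583):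
`expSum a x t = Σᵢ aᵢ e^{xᵢ t}`, `classSum a x w = Σ_{xᵢ = w} aᵢ`; its B3 `robust_term_count'` counts the zeros of a convergent family in a fixed
window by the ACTIVE limit classes — and is void when every limit class sum vanishes (a BLOWN-UP cluster: the first-order limit is `≡ 0`).
This file is the next order («B1 + B3 with a ν-level twist», card `Lines/wall_bubbling.md`, STATUS (M) / ADDENDA 4–5; the CONFLUENT SLOT
`t·e^{wt}` of (W)):
* `expSum_twist_deriv` — twisting at a LEVEL-ν centre `v` and differentiating gives the exponential sum with coefficients `aᵢ(xᵢ − v)` and the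
  SAME exponents (product rule);
* `expSum_smul_coeff`, `card_zeros_le_card_zeros_twistDeriv_add_one` — one twist–differentiate–RENORMALISE step (`aᵢ ↦ aᵢ(xᵢ − v)/ρ`, `ρ` the
  vanishing rate) costs at most ONE zero in any window (Rolle, distinct zeros, no multiplicities);
* **`robust_term_count_secondOrder`** — if after one such step the family converges coefficientwise with an active limit class (actives in
  `V`), then for all large `ν` every finite zero set of the ORIGINAL sum in `[−R, R]` has at most `#V` elements — NO convergence of the original
  coefficients is assumed (they may diverge, or converge with all class sums zero); the extra unit over B3's `#V − 1` is the confluent slot;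
* **`robust_term_count_order`** — the same after `k` successive steps (centres `v_j^ν`, rates `ρ_j^ν`; no `ρ ≠ 0` hypothesis is needed since `x/0 = 0`): `#zeros + 1 ≤ #V + k` eventually
  (`k = 0` is B3, `k = 1` the second order): the window profile at a coincidence of depth `k` costs exactly `k` zeros over the first-order count.
HONEST FRAMING.  Elementary real analysis (Rolle + the chain's B3); a counting TOOL for the blown-up cluster of (M) and the confluent Weyl slot of
(W), which remain OPEN; nothing here bears on `DoorA26` (OPEN), on `MatrixDescartes` (stmt-18050) or on VP ≠ VNP.  Mathlib-only mathematics,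
no definitions. [folklore: Laguerre's twisted Rolle for (extended) exponential sums, Braess 1986 VI §1–2]
-/

-- `Summit.ValiantsHypothesis.ValiantsHypothesis.…` repeats a component by the D-0017 layout (single-conjunct summit); the name is mandated.
set_option linter.dupNamespace false
set_option autoImplicit false

namespace Summit.ValiantsHypothesis.ValiantsHypothesis.Theorems.LacunarySymmetroidMatrixDescartes.WallBubbling.Bubbling

open Finset Filter Topology

variable {ι : Type*} [Fintype ι]

/-! ## 1. One twist–differentiate–renormalise step at level `ν` -/

/-- **twisted derivative at a level-`ν` centre**: `d/dt [e^{−vt}·Σ aᵢe^{xᵢt}] = e^{−vt}·Σ aᵢ(xᵢ − v)e^{xᵢt}` — the exponents do not move.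
[folklore] -/
theorem expSum_twist_deriv (a x : ι → ℝ) (v t : ℝ) :
    HasDerivAt (fun s => Real.exp (-(v * s)) * expSum a x s) (Real.exp (-(v * t)) * expSum (fun i => a i * (x i - v)) x t) t := by
  have h1 : (fun s => Real.exp (-(v * s)) * expSum a x s) = expSum a (fun i => x i - v) := funext fun s => expSum_twist a x v s
  rw [h1, expSum_twist (fun i => a i * (x i - v)) x v t]
  exact hasDerivAt_expSum a (fun i => x i - v) t

/-- scaling the coefficients scales the sum. [bookkeeping] -/
theorem expSum_smul_coeff (a x : ι → ℝ) (c t : ℝ) : expSum (fun i => c * a i) x t = c * expSum a x t := by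
  unfold expSum
  rw [Finset.mul_sum]
  exact Finset.sum_congr rfl fun i _ => by ring

/-- **ONE STEP COSTS ONE ZERO**: if `Σ aᵢe^{xᵢt}` vanishes on a finite set `Z ⊆ [A, B]`, then the renormalised twisted derivative
`Σ (aᵢ(xᵢ − v)/ρ) e^{xᵢt}` vanishes on a finite `Z' ⊆ [A, B]` with `#Z ≤ #Z' + 1` (for `ρ = 0` Lean's `x/0 = 0` makes this trivial).
[folklore: Rolle] -/
theorem card_zeros_le_card_zeros_twistDeriv_add_one (a x : ι → ℝ) (v ρ : ℝ) (A B : ℝ) (Z : Finset ℝ)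
    (hZ : ∀ z ∈ Z, z ∈ Set.Icc A B ∧ expSum a x z = 0) :
    ∃ Z' : Finset ℝ, Z.card ≤ Z'.card + 1 ∧ ∀ z ∈ Z', z ∈ Set.Icc A B ∧ expSum (fun i => a i * (x i - v) / ρ) x z = 0 := by
  have hderiv := fun t => expSum_twist_deriv a x v t
  have hZ1 : ∀ z ∈ Z, z ∈ Set.Icc A B ∧ (fun s => Real.exp (-(v * s)) * expSum a x s) z = 0 :=
    fun z hz => ⟨(hZ z hz).1, by simp only [(hZ z hz).2, mul_zero]⟩
  obtain ⟨Z', hcard, hZ'⟩ := rolle_count hderiv A B Z hZ1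
  refine ⟨Z', hcard, fun z hz => ⟨(hZ' z hz).1, ?_⟩⟩
  have h' : expSum (fun i => a i * (x i - v)) x z = 0 := (mul_eq_zero.1 (hZ' z hz).2).resolve_left (Real.exp_pos _).ne'
  have hsc : expSum (fun i => a i * (x i - v) / ρ) x z = ρ⁻¹ * expSum (fun i => a i * (x i - v)) x z := by
    rw [← expSum_smul_coeff]
    exact congrArg (fun c => expSum c x z) (funext fun i => by rw [div_eq_inv_mul])
  rw [hsc, h', mul_zero]

/-! ## 2. The robust term count, second order -/

/-- **ROBUST TERM COUNT, SECOND ORDER.**  Let `g_ν = Σᵢ aᵢ^ν e^{xᵢ^ν t}` with exponentwise limits `x₀`; NO convergence of the coefficients is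
assumed.  If for some centres `v^ν` and rates `ρ^ν` the renormalised twisted coefficients `aᵢ^ν(xᵢ^ν − v^ν)/ρ^ν` converge to `b₀` and the
limit `(b₀, x₀)` has an ACTIVE class (all active classes in `V`), then for every window `[−R, R]` and all large `ν`, every finite set of zeros of
`g_ν` in the window has at most `#V` elements (one more than B3's `#V − 1`: the confluent slot). [this file] -/
theorem robust_term_count_secondOrder (a x : ℕ → ι → ℝ) (x₀ b₀ : ι → ℝ) (v ρ : ℕ → ℝ)
    (hx : ∀ i, Tendsto (fun ν => x ν i) atTop (𝓝 (x₀ i)))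
    (hb : ∀ i, Tendsto (fun ν => a ν i * (x ν i - v ν) / ρ ν) atTop (𝓝 (b₀ i)))
    (V : Finset ℝ) (hV : ∀ w, classSum b₀ x₀ w ≠ 0 → w ∈ V) (hne : ∃ w, classSum b₀ x₀ w ≠ 0) (R : ℝ) :
    ∀ᶠ ν in atTop, ∀ Z : Finset ℝ, (∀ z ∈ Z, z ∈ Set.Icc (-R) R ∧ expSum (a ν) (x ν) z = 0) → Z.card ≤ V.card := by
  have h := robust_term_count' (fun ν i => a ν i * (x ν i - v ν) / ρ ν) x b₀ x₀ V hb hx hV hne R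
  filter_upwards [h] with ν hν Z hZ
  obtain ⟨Z', hcard, hZ'⟩ := card_zeros_le_card_zeros_twistDeriv_add_one (a ν) (x ν) (v ν) (ρ ν) (-R) R Z hZ
  have := hν Z' hZ'
  omega

/-! ## 3. The robust term count of order `k` -/

/-- **ROBUST TERM COUNT OF ORDER `k`.**  `c 0 = ` the coefficient family of `g_ν`; `c (j+1)` is obtained from `c j` by the twist–differentiate–
renormalise step with centres `v j ν` and rates `ρ j ν` (`j < k`), exponents fixed at `x ν → x₀`.  If `c k` converges coefficientwise to `c₀`
and `(c₀, x₀)` has an active class (actives in `V`), then for every window and all large `ν`: `#zeros of g_ν + 1 ≤ #V + k`. [this file] -/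
theorem robust_term_count_order (k : ℕ) :
    ∀ (c : ℕ → ℕ → ι → ℝ) (x : ℕ → ι → ℝ) (x₀ c₀ : ι → ℝ) (v ρ : ℕ → ℕ → ℝ),
      (∀ j, j < k → ∀ ν i, c (j + 1) ν i = c j ν i * (x ν i - v j ν) / ρ j ν) →
      (∀ i, Tendsto (fun ν => x ν i) atTop (𝓝 (x₀ i))) →
      (∀ i, Tendsto (fun ν => c k ν i) atTop (𝓝 (c₀ i))) →
      ∀ V : Finset ℝ, (∀ w, classSum c₀ x₀ w ≠ 0 → w ∈ V) → (∃ w, classSum c₀ x₀ w ≠ 0) →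
      ∀ R : ℝ, ∀ᶠ ν in atTop, ∀ Z : Finset ℝ,
        (∀ z ∈ Z, z ∈ Set.Icc (-R) R ∧ expSum (c 0 ν) (x ν) z = 0) → Z.card + 1 ≤ V.card + k := by
  induction k with
  | zero =>
    intro c x x₀ c₀ v ρ _ hx hc V hV hne R
    filter_upwards [robust_term_count' (c 0) x c₀ x₀ V hc hx hV hne R] with ν hν Z hZ
    have := hν Z hZ
    omega
  | succ k ih =>
    intro c x x₀ c₀ v ρ hstep hx hc V hV hne R
    -- the shifted chain `c' j = c (j+1)` has `k` steps and the same limit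
    have h := ih (fun j => c (j + 1)) x x₀ c₀ (fun j => v (j + 1)) (fun j => ρ (j + 1))
      (fun j hj ν i => hstep (j + 1) (by omega) ν i) hx hc V hV hne R
    filter_upwards [h] with ν hν Z hZ
    obtain ⟨Z', hcard, hZ'⟩ := card_zeros_le_card_zeros_twistDeriv_add_one (c 0 ν) (x ν) (v 0 ν) (ρ 0 ν) (-R) R Z hZ
    have hc1 : (fun i => c 0 ν i * (x ν i - v 0 ν) / ρ 0 ν) = c (0 + 1) ν := funext fun i => (hstep 0 (by omega) ν i).symm
    rw [hc1] at hZ'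
    have := hν Z' hZ'
    omega

end Summit.ValiantsHypothesis.ValiantsHypothesis.Theorems.LacunarySymmetroidMatrixDescartes.WallBubbling.Bubbling
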